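import Mathlib
import Summits.Ventures.PercRepro2.Defs

/-!
# Coordinates, updates and differing-coordinate counts on the configuration cube
(blind cell PercRepro2, mine-1 g37; lemmas for the shape theorem on the cube,
`BoxUnionShapePercCore.lean`; paper proof proofs/MINE1-BOXUNION-SHAPE.md, part B)

On `Config E = E → Bool` with the product order: a strict inequality `a < b` has a coordinate with
`a e = false`, `b e = true` (`exists_coord_of_lt`), a failure of `a ≤ b` a coordinate with
`a e = true`, `b e = false` (`exists_coord_of_not_le`); the one-coordinate updates `x[e↦1]`,
`z[e↦0]` stay inside an interval (`update_true_le`, `le_update_false`) and move strictly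
(`lt_update_true`, `update_false_lt`); and updating one configuration at a coordinate where it
differs from the other, to the other's value, strictly decreases the number of differing
coordinates (`card_diff_update_lt`, `card_diff_update_right_lt`) — the measure of the strong
inductions in the core file.
-/

namespace Summit.Ventures.PercRepro2

open Finset

open scoped Classical

section Coordinates

variable {E : Type*}

/-- A strict inequality of configurations has a coordinate `false < true`. -/
lemma exists_coord_of_lt {a b : Config E} (h : a < b) : ∃ e, a e = false ∧ b e = true := by
  by_contra hcon
  simp only [not_exists, not_and] at hcon
  apply h.ne
  funext e
  cases ha : a e <;> cases hb : b e
  · rfl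
  · exact absurd hb (hcon e ha)
  · have hle := h.le e
    rw [ha, hb] at hle
    exact (Bool.false_ne_true (Bool.le_iff_imp.mp hle rfl)).elim
  · rfl

/-- A failure of `a ≤ b` has a coordinate `true > false`. -/
lemma exists_coord_of_not_le {a b : Config E} (h : ¬ a ≤ b) : ∃ e, a e = true ∧ b e = false := by
  by_contra hcon
  simp only [not_exists, not_and] at hcon
  apply h
  intro e
  cases ha : a e <;> cases hb : b e
  · exact le_rfl
  · exact Bool.false_le _
  · exact absurd hb (hcon e ha)
  · exact le_rfl

/-- `true ≤ b e` forces `b e = true`. -/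
lemma eq_true_of_true_le {b : Config E} {e : E} (h : true ≤ b e) : b e = true :=
  Bool.le_iff_imp.mp h rfl

/-- `a e ≤ false` forces `a e = false`. -/
lemma eq_false_of_le_false {a : Config E} {e : E} (h : a e ≤ false) : a e = false :=
  Bool.eq_false_iff.mpr fun ht => Bool.false_ne_true (Bool.le_iff_imp.mp h ht)

end Coordinates

section Updates

variable {E : Type*} [DecidableEq E]

/-- `x[e↦1] ≤ y` when `x ≤ y` and `y e = true`. -/
lemma update_true_le {x y : Config E} (hxy : x ≤ y) {e : E} (hye : y e = true) :
    Function.update x e true ≤ y := by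
  intro e'
  by_cases h : e' = e
  · subst h; simp [hye]
  · rw [Function.update_of_ne h]; exact hxy e'

/-- `y ≤ z[e↦0]` when `y ≤ z` and `y e = false`. -/
lemma le_update_false {y z : Config E} (hyz : y ≤ z) {e : E} (hye : y e = false) :
    y ≤ Function.update z e false := by
  intro e'
  by_cases h : e' = e
  · subst h; simp [hye]
  · rw [Function.update_of_ne h]; exact hyz e'

/-- `x < x[e↦1]` when `x e = false`. -/
lemma lt_update_true {x : Config E} {e : E} (hxe : x e = false) :
    x < Function.update x e true := by
  refine lt_of_le_of_ne (fun e' => ?_) (fun h => ?_)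
  · by_cases h : e' = e
    · subst h; simp [hxe]
    · exact (Function.update_of_ne h true x).symm.le
  · have := congrFun h e; simp [hxe] at this

/-- `z[e↦0] < z` when `z e = true`. -/
lemma update_false_lt {z : Config E} {e : E} (hze : z e = true) :
    Function.update z e false < z := by
  refine lt_of_le_of_ne (fun e' => ?_) (fun h => ?_)
  · by_cases h : e' = e
    · subst h; simp [hze]
    · exact (Function.update_of_ne h false z).le
  · have := congrFun h e; simp [hze] at this

end Updates

section Cards

variable {E : Type*} [Fintype E] [DecidableEq E]

/-- Updating `x` at a coordinate where it differs from `z`, to the value of `z`, strictly shrinks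
the set of differing coordinates. -/
lemma card_diff_update_lt {x z : Config E} {e : E} {v : Bool} (hne : x e ≠ z e) (hv : v = z e) :
    (univ.filter fun e' => Function.update x e v e' ≠ z e').card <
      (univ.filter fun e' => x e' ≠ z e').card := by
  have hsub : (univ.filter fun e' => Function.update x e v e' ≠ z e') ⊆
      (univ.filter fun e' => x e' ≠ z e') := by
    intro e' he'
    simp only [Finset.mem_filter, Finset.mem_univ, true_and] at he' ⊢
    by_cases h : e' = e
    · subst h; simp [hv] at he'
    · rwa [Function.update_of_ne h] at he'
  exact Finset.card_lt_card ((Finset.ssubset_iff_of_subset hsub).mpr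
    ⟨e, by simp [hne], by simp [hv]⟩)

/-- The same for an update of the second configuration. -/
lemma card_diff_update_right_lt {x z : Config E} {e : E} {v : Bool} (hne : x e ≠ z e)
    (hv : v = x e) :
    (univ.filter fun e' => x e' ≠ Function.update z e v e').card <
      (univ.filter fun e' => x e' ≠ z e').card := by
  have hsub : (univ.filter fun e' => x e' ≠ Function.update z e v e') ⊆
      (univ.filter fun e' => x e' ≠ z e') := by
    intro e' he'
    simp only [Finset.mem_filter, Finset.mem_univ, true_and] at he' ⊢
    by_cases h : e' = e
    · subst h; simp [hv] at he'
    · rwa [Function.update_of_ne h] at he'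
  exact Finset.card_lt_card ((Finset.ssubset_iff_of_subset hsub).mpr
    ⟨e, by simp [hne], by simp [hv]⟩)

end Cards

end Summit.Ventures.PercRepro2
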